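import Mathlib.Analysis.MeanInequalities
import Mathlib.Algebra.Order.Chebyshev
import Literature.Analysis.PDE.TorusWordCalculus
import Literature.Analysis.FunctionSpaces.TorusFourierSynthesis
import Literature.Analysis.FunctionSpaces.TorusFourierCalculus
import Literature.Analysis.FunctionSpaces.TorusScalarFourierSeries
import Literature.Analysis.FunctionSpaces.TorusSobolevNormEmbeddingProofs
import Literature.Analysis.FunctionSpaces.Complexify
import HarnessLib

/-!
# `H^σ(𝕋^ι) ⊂ L^∞(𝕋^ι)` in word form for `2σ > #ι` (all dimensions)

The **word-form Sobolev sup embedding** `Torus.WordSupEmbedding ι σ`: for every finite-dimensional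
real normed target `F'` there is `C_s > 0` with `‖f x‖² ≤ C_s · twordEnergy σ f` for every smooth
`f : 𝕋^ι → F'` and every `x`, where `twordEnergy σ f = Σ_{|w| ≤ σ} ∫_𝕋 ‖∂^w f‖²` is the sum-form
`H^σ` energy of `Literature.Analysis.PDE.TorusWordCalculus` (Majda's `‖u‖²_σ`). The main theorem
`Torus.wordSupEmbedding_of_lt` proves it for all `#ι < 2σ` by the printed spectral argument
(Grafakos 2014, §3.3.3 with Prop. 3.2.5; on `ℝ^d` Bahouri–Chemin–Danchin 2011, Thm. 1.50):
(1) reduce `F'` to `ℝⁿ` by a linear equivalence (`Torus.twordEnergy_clm_comp_le`);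
(2) complexify `v : 𝕋^ι → ℝ^κ` and use Fourier inversion for smooth functions,
`‖v x‖ ≤ Σ_k ‖𝓕v(k)‖` (`Torus.norm_le_tsum_norm_mFourierCoeff_complexify`);
(3) Cauchy–Schwarz against the lattice `p`-series `Σ_k (1 + |k|²)^{-σ}` (`2σ > #ι`,
`Torus.summable_one_add_freqNormSq_rpow_neg_of_lt`);
(4) the power-mean bound `(1 + |k|²)^σ ≤ (#ι + 1)^{σ-1} (1 + Σ_j k_j^{2σ})`
(`Torus.one_add_freqNormSq_pow_succ_le`) and Parseval for the pure derivatives,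
`Σ_k (4π² k_j²)^σ ‖𝓕v(k)‖² = ∫ ‖∂_j^σ v‖²` (`Torus.hasSum_pureFreq_pow_mul_norm_sq_mFourierCoeff`),
each a single word of `twordEnergy σ v`.

The instance `Torus.wordSupEmbedding_fin3_two` (`H²(𝕋³)`) is the tree's real-variable
`Literature.Analysis.PDE.exists_norm_sq_le_twordEnergy_two`; `Torus.wordSupEmbedding_fin4_three`
(`H³(𝕋⁴) ⊂ L^∞`) is the instance a four-dimensional symmetric-hyperbolic energy chain consumes.
Everything is proved; no named facts, instances or notation are introduced.

## Mathlib / tree search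

Mathlib (this pin) has no Sobolev scale on `UnitAddTorus` (its `ℝⁿ` file
`Mathlib/Analysis/Distribution/Sobolev.lean` has `MemSobolev.fourier_memL1`, the analogue of (3));
searched `mFourierCoeff.*tsum`, `Sobolev`, `supNorm`. The tree has `H^s ⊂ C` for the spectral norm
and complex targets (`Torus.MemSobolev.continuous_of_lt_holds`) and the word-form sup bound only on
`𝕋³` with margin `2` (`exists_norm_sq_le_twordEnergy_two`; searched `twordEnergy`, `norm_sq_le`,
`WordSup`). Reused by name: `Torus.IsSmooth.fourierSynth_mFourierCoeff`,
`Torus.hasSum_sq_mFourierCoeff_euclidean`, `Torus.mFourierCoeff_partialDeriv_iterate`, Mathlib's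
`pow_sum_le_card_mul_sum_pow`, `Real.inner_le_Lp_mul_Lq_tsum_of_nonneg`.

## References

* L. Grafakos, *Classical Fourier Analysis*, 3rd ed., GTM 249 (Springer 2014), Prop. 3.2.5,
  Prop. 3.2.7 (3), §3.3.3 (the paragraph after Def. 3.3.15). [Grafakos2014]
* H. Bahouri, J.-Y. Chemin, R. Danchin, *Fourier Analysis and Nonlinear PDEs* (Springer 2011),
  Thm. 1.50. [BahouriCheminDanchin2011]
* A. Majda, *Compressible Fluid Flow and Systems of Conservation Laws in Several Space
  Variables* (Springer 1984), Ch. 2 §2.1 (the sum-form norms `‖u‖_m`). [Majda1984]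
* R. A. Adams, *Sobolev Spaces* (Academic Press 1975), Thm. 5.4. [Adams1975]
-/

noncomputable section

open MeasureTheory Set Filter Function UnitAddTorus
open scoped ContDiff Topology BigOperators

namespace Literature.Analysis.FunctionSpaces

namespace Torus

open Literature.Analysis.PDE

variable {ι : Type*} [Fintype ι] [DecidableEq ι]

/-! ## Word derivatives and continuous linear maps -/

section Clm

variable {F' G' : Type*} [NormedAddCommGroup F'] [NormedSpace ℝ F'] [NormedAddCommGroup G']
  [NormedSpace ℝ G']

/-- Iterated partials commute with continuous linear maps, `∂^w (L ∘ f) = L ∘ ∂^w f` (`f` smooth;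
the public form of the private `iterPartialDeriv_clm_comp` of `TorusDnormFourierTail`).
[folklore] -/
private theorem iterPartialDeriv_comp_clm {f : UnitAddTorus ι → F'} (hf : IsSmooth f) (L : F' →L[ℝ] G') :
    ∀ w : List ι, iterPartialDeriv w (⇑L ∘ f) = ⇑L ∘ iterPartialDeriv w f
  | [] => rfl
  | i :: w => by
    rw [iterPartialDeriv_cons, iterPartialDeriv_cons, iterPartialDeriv_comp_clm hf L w]
    funext x
    exact partialDeriv_clm_comp (hf.iterPartialDeriv w) L i x

/-- `∫ ‖∂^w (L ∘ f)‖² ≤ ‖L‖² ∫ ‖∂^w f‖²` for smooth `f`. [folklore] -/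
private theorem integral_norm_sq_iterPartialDeriv_comp_clm_le {f : UnitAddTorus ι → F'} (hf : IsSmooth f)
    (L : F' →L[ℝ] G') (w : List ι) :
    ∫ x, ‖iterPartialDeriv w (⇑L ∘ f) x‖ ^ 2 ≤ ‖L‖ ^ 2 * ∫ x, ‖iterPartialDeriv w f x‖ ^ 2 := by
  rw [iterPartialDeriv_comp_clm hf L w, ← integral_const_mul]
  refine integral_mono_of_nonneg (Eventually.of_forall fun x => sq_nonneg _)
    ((((hf.iterPartialDeriv w).continuous.norm.pow 2).integrable_unitAddTorus).const_mul _)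
    (Eventually.of_forall fun x => ?_)
  have h := L.le_opNorm (iterPartialDeriv w f x)
  calc ‖(⇑L ∘ iterPartialDeriv w f) x‖ ^ 2 = ‖L (iterPartialDeriv w f x)‖ ^ 2 := rfl
    _ ≤ (‖L‖ * ‖iterPartialDeriv w f x‖) ^ 2 := pow_le_pow_left₀ (norm_nonneg _) h 2
    _ = ‖L‖ ^ 2 * ‖iterPartialDeriv w f x‖ ^ 2 := mul_pow _ _ 2

/-- **`twordEnergy m (L ∘ f) ≤ ‖L‖² · twordEnergy m f`** for smooth `f` and a continuous linear
`L`. [folklore] -/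
private theorem twordEnergy_clm_comp_le {f : UnitAddTorus ι → F'} (hf : IsSmooth f) (L : F' →L[ℝ] G')
    (m : ℕ) : twordEnergy m (⇑L ∘ f) ≤ ‖L‖ ^ 2 * twordEnergy m f := by
  rw [twordEnergy_def, twordEnergy_def, Finset.mul_sum]
  exact Finset.sum_le_sum fun w _ => integral_norm_sq_iterPartialDeriv_comp_clm_le hf L w

end Clm

/-! ## Pure derivatives and their Fourier coefficients -/

section Pure

variable {F' : Type*} [NormedAddCommGroup F'] [NormedSpace ℝ F']

omit [Fintype ι] in
/-- A pure word is an iterate: `∂^{(j,…,j)} f = ∂ⱼ^m f`. [folklore] -/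
private theorem iterPartialDeriv_replicate (j : ι) (f : UnitAddTorus ι → F') :
    ∀ m : ℕ, iterPartialDeriv (List.replicate m j) f = (partialDeriv j)^[m] f
  | 0 => rfl
  | m + 1 => by
    rw [List.replicate_succ, iterPartialDeriv_cons, iterPartialDeriv_replicate j f m,
      Function.iterate_succ', Function.comp_apply]

variable {κ : Type*} [Fintype κ]

/-- The word derivatives of the complexification are the complexified word derivatives, so their
norms agree: `‖∂^w (complexify ∘ v) x‖ = ‖∂^w v x‖`. [folklore] -/
private theorem norm_iterPartialDeriv_complexify_comp {v : UnitAddTorus ι → EuclideanSpace ℝ κ}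
    (hv : IsSmooth v) (w : List ι) (x : UnitAddTorus ι) :
    ‖iterPartialDeriv w (EuclideanSpace.complexify ∘ v) x‖ = ‖iterPartialDeriv w v x‖ := by
  have h : iterPartialDeriv w (EuclideanSpace.complexify ∘ v) =
      ⇑(EuclideanSpace.complexify.toContinuousLinearMap) ∘ iterPartialDeriv w v :=
    iterPartialDeriv_comp_clm hv EuclideanSpace.complexify.toContinuousLinearMap w
  rw [h, Function.comp_apply, LinearIsometry.coe_toContinuousLinearMap,
    EuclideanSpace.norm_complexify]

/-- **Fourier inversion bound for smooth real vector fields**: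
`‖v x‖ ≤ Σ_k ‖𝓕(complexify ∘ v)(k)‖` (absolutely convergent Fourier series of a smooth function
and `|e_k(x)| = 1`; `Torus.norm_le_tsum_norm_mFourierCoeff` of `TorusAgmonExplicit` is the case
`κ = ι`, same proof). [cite: Grafakos2014, Prop. 3.2.5] -/
theorem norm_le_tsum_norm_mFourierCoeff_complexify {v : UnitAddTorus ι → EuclideanSpace ℝ κ}
    (hv : IsSmooth v) (x : UnitAddTorus ι) :
    ‖v x‖ ≤ ∑' k : ι → ℤ, ‖mFourierCoeff (EuclideanSpace.complexify ∘ v) k‖ := by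
  set w : UnitAddTorus ι → EuclideanSpace ℂ κ := EuclideanSpace.complexify ∘ v with hw_def
  have hw : IsSmooth w := hv.comp_clm EuclideanSpace.complexify.toContinuousLinearMap
  have hc := hw.rapidDecay_mFourierCoeff
  have hsum : HasSum (fun k => mFourier k x • mFourierCoeff w k) (w x) := by
    have := hc.hasSum_fourierSynth x
    rwa [hw.fourierSynth_mFourierCoeff] at this
  have hsn : Summable fun k => ‖mFourier k x • mFourierCoeff w k‖ := by
    simp_rw [norm_mFourier_smul]
    exact hc.summable_norm
  calc ‖v x‖ = ‖w x‖ := by rw [hw_def, Function.comp_apply, EuclideanSpace.norm_complexify]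
    _ = ‖∑' k, mFourier k x • mFourierCoeff w k‖ := by rw [hsum.tsum_eq]
    _ ≤ ∑' k, ‖mFourier k x • mFourierCoeff w k‖ := norm_tsum_le_tsum_norm hsn
    _ = ∑' k, ‖mFourierCoeff w k‖ := tsum_congr fun k => norm_mFourier_smul k x _

/-- **Parseval for a pure derivative**: `Σ_k (4π² k_j²)^m ‖𝓕(complexify ∘ v)(k)‖² = ∫ ‖∂ⱼ^m v‖²`
for smooth `v : 𝕋^ι → ℝ^κ` (`𝓕(∂ⱼ^m g)(k) = (2πi k_j)^m 𝓕g(k)` and Parseval).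
[cite: Grafakos2014, Prop. 3.2.7 (3)] -/
theorem hasSum_pureFreq_pow_mul_norm_sq_mFourierCoeff {v : UnitAddTorus ι → EuclideanSpace ℝ κ}
    (hv : IsSmooth v) (j : ι) (m : ℕ) :
    HasSum (fun k : ι → ℤ => (4 * Real.pi ^ 2 * ((k j : ℝ)) ^ 2) ^ m *
        ‖mFourierCoeff (EuclideanSpace.complexify ∘ v) k‖ ^ 2)
      (∫ x, ‖iterPartialDeriv (List.replicate m j) v x‖ ^ 2) := by
  have hg : IsSmooth (EuclideanSpace.complexify ∘ v : UnitAddTorus ι → EuclideanSpace ℂ κ) :=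
    hv.comp_clm EuclideanSpace.complexify.toContinuousLinearMap
  have h := hasSum_sq_mFourierCoeff_euclidean (hg.iterPartialDeriv (List.replicate m j)).continuous
  simp_rw [norm_iterPartialDeriv_complexify_comp hv] at h
  rw [iterPartialDeriv_replicate] at h
  simp_rw [mFourierCoeff_partialDeriv_iterate hg j m, norm_smul, norm_pow, mul_pow] at h
  refine h.congr_fun fun k => ?_
  congr 1
  have hck : ‖(2 * Real.pi * Complex.I * (k j : ℂ))‖ ^ 2 = 4 * Real.pi ^ 2 * (k j : ℝ) ^ 2 := by
    simp only [norm_mul, Complex.norm_ofNat, Complex.norm_real, Real.norm_eq_abs,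
      Complex.norm_I, mul_one, Complex.norm_intCast, abs_of_pos Real.pi_pos]
    rw [mul_pow, mul_pow, sq_abs]
    ring
  rw [← hck, ← pow_mul, ← pow_mul, Nat.mul_comm 2 m]

omit [DecidableEq ι] in
/-- Zeroth case: `Σ_k ‖𝓕(complexify ∘ v)(k)‖² = ∫ ‖v‖²`. [cite: Grafakos2014, Prop. 3.2.7 (3)] -/
theorem hasSum_norm_sq_mFourierCoeff_complexify {v : UnitAddTorus ι → EuclideanSpace ℝ κ}
    (hv : IsSmooth v) :
    HasSum (fun k : ι → ℤ => ‖mFourierCoeff (EuclideanSpace.complexify ∘ v) k‖ ^ 2)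
      (∫ x, ‖v x‖ ^ 2) := by
  have hg : IsSmooth (EuclideanSpace.complexify ∘ v : UnitAddTorus ι → EuclideanSpace ℂ κ) :=
    hv.comp_clm EuclideanSpace.complexify.toContinuousLinearMap
  have h := hasSum_sq_mFourierCoeff_euclidean hg.continuous
  have hnorm : ∀ x, ‖(EuclideanSpace.complexify ∘ v) x‖ = ‖v x‖ :=
    fun x => EuclideanSpace.norm_complexify _
  simp_rw [hnorm] at h
  exact h

end Pure

/-! ## The lattice weights -/

omit [DecidableEq ι] in
/-- **Power-mean bound for the Sobolev weight**:
`(1 + |k|²)^{n+1} ≤ (#ι + 1)^n · (1 + Σ_j (k_j²)^{n+1})` (convexity of `t ↦ t^{n+1}` on the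
`#ι + 1` numbers `1, k_1², …, k_d²`). [folklore] -/
private theorem one_add_freqNormSq_pow_succ_le (k : ι → ℤ) (n : ℕ) :
    (1 + freqNormSq k) ^ (n + 1) ≤
      ((Fintype.card ι : ℝ) + 1) ^ n * (1 + ∑ j, ((k j : ℝ) ^ 2) ^ (n + 1)) := by
  classical
  let a : Option ι → ℝ := fun o => Option.elim o 1 fun j => (k j : ℝ) ^ 2
  have ha : ∀ o ∈ (Finset.univ : Finset (Option ι)), 0 ≤ a o := by
    rintro (_ | j) -
    · exact zero_le_one
    · exact sq_nonneg _
  have hsum : ∑ o, a o = 1 + freqNormSq k := by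
    rw [Fintype.sum_option, freqNormSq]; rfl
  have hsum' : ∑ o, a o ^ (n + 1) = 1 + ∑ j, ((k j : ℝ) ^ 2) ^ (n + 1) := by
    rw [Fintype.sum_option]
    simp [a]
  have h := pow_sum_le_card_mul_sum_pow ha n
  rw [Finset.card_univ, Fintype.card_option, hsum, hsum'] at h
  push_cast at h
  exact h

/-! ## The embedding for Euclidean targets -/

section Euclidean

variable (κ : Type*) [Fintype κ]

/-- **`H^σ(𝕋^ι; ℝ^κ) ⊂ L^∞` in word form**, `#ι < 2σ`: there is `C > 0` with
`‖v x‖² ≤ C · twordEnergy σ v` for all smooth `v : 𝕋^ι → ℝ^κ` and all `x`; explicitly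
`C = (Σ_k (1 + |k|²)^{-σ}) (#ι + 1)^σ + 1`.
[cite: Grafakos2014, §3.3.3 (after Def. 3.3.15) with Prop. 3.2.5] -/
theorem exists_norm_sq_le_twordEnergy_euclidean {σ : ℕ} (hσ : Fintype.card ι < 2 * σ) :
    ∃ C : ℝ, 0 < C ∧ ∀ v : UnitAddTorus ι → EuclideanSpace ℝ κ, IsSmooth v → ∀ x,
      ‖v x‖ ^ 2 ≤ C * twordEnergy σ v := by
  classical
  obtain ⟨n, rfl⟩ : ∃ n, σ = n + 1 := ⟨σ - 1, by omega⟩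
  -- the lattice `p`-series
  have hZs : Summable fun k : ι → ℤ => (1 + freqNormSq k) ^ (-((n + 1 : ℕ) : ℝ)) :=
    summable_one_add_freqNormSq_rpow_neg_of_lt (by exact_mod_cast hσ)
  set Z : ℝ := ∑' k : ι → ℤ, (1 + freqNormSq k) ^ (-((n + 1 : ℕ) : ℝ)) with hZ_def
  have hZ0 : 0 ≤ Z := tsum_nonneg fun k => by have := freqNormSq_nonneg k; positivity
  set D : ℝ := ((Fintype.card ι : ℝ) + 1) ^ n with hD_def
  have hD0 : 0 ≤ D := by positivity
  refine ⟨Z * (D * ((Fintype.card ι : ℝ) + 1)) + 1, by positivity, fun v hv x => ?_⟩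
  set E : ℝ := twordEnergy (n + 1) v with hE_def
  have hE0 : 0 ≤ E := twordEnergy_nonneg _ _
  have h4 : (1 : ℝ) ≤ 4 * Real.pi ^ 2 := by nlinarith [Real.pi_gt_three]
  -- coefficients and weights
  set c : (ι → ℤ) → ℝ := fun k => ‖mFourierCoeff (EuclideanSpace.complexify ∘ v) k‖ with hc_def
  have hc0 : ∀ k, 0 ≤ c k := fun k => norm_nonneg _
  set W : (ι → ℤ) → ℝ := fun k => (1 + freqNormSq k) ^ (n + 1) with hW_def
  have hW1 : ∀ k, 1 ≤ W k := fun k => one_le_pow₀ (one_le_one_add_freqNormSq k)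
  have hW0 : ∀ k, 0 ≤ W k := fun k => zero_le_one.trans (hW1 k)
  -- the dominating family `G` and its sum
  set G : (ι → ℤ) → ℝ := fun k => D * (c k ^ 2 +
      ∑ j, (4 * Real.pi ^ 2 * ((k j : ℝ)) ^ 2) ^ (n + 1) * c k ^ 2) with hG_def
  have hG : HasSum G (D * ((∫ y, ‖v y‖ ^ 2) +
      ∑ j, ∫ y, ‖iterPartialDeriv (List.replicate (n + 1) j) v y‖ ^ 2)) :=
    ((hasSum_norm_sq_mFourierCoeff_complexify hv).add
      (hasSum_sum fun j _ => hasSum_pureFreq_pow_mul_norm_sq_mFourierCoeff hv j (n + 1))).mul_left D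
  have hGle : D * ((∫ y, ‖v y‖ ^ 2) +
      ∑ j, ∫ y, ‖iterPartialDeriv (List.replicate (n + 1) j) v y‖ ^ 2) ≤
      D * ((Fintype.card ι : ℝ) + 1) * E := by
    have h0 : ∫ y, ‖v y‖ ^ 2 ≤ E := integral_norm_sq_le_twordEnergy _ v
    have hj : ∀ j, ∫ y, ‖iterPartialDeriv (List.replicate (n + 1) j) v y‖ ^ 2 ≤ E := fun j =>
      integral_norm_sq_iterPartialDeriv_le_twordEnergy (by rw [List.length_replicate]) v
    have hs : ∑ j, ∫ y, ‖iterPartialDeriv (List.replicate (n + 1) j) v y‖ ^ 2 ≤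
        (Fintype.card ι : ℝ) * E := by
      refine (Finset.sum_le_sum fun j _ => hj j).trans ?_
      rw [Finset.sum_const, Finset.card_univ, nsmul_eq_mul]
    calc D * ((∫ y, ‖v y‖ ^ 2) + ∑ j, ∫ y, ‖iterPartialDeriv (List.replicate (n + 1) j) v y‖ ^ 2)
        ≤ D * (E + (Fintype.card ι : ℝ) * E) := by gcongr
      _ = D * ((Fintype.card ι : ℝ) + 1) * E := by ring
  -- the Cauchy–Schwarz factors
  set f : (ι → ℤ) → ℝ := fun k => Real.sqrt (W k) * c k with hf_def
  set g : (ι → ℤ) → ℝ := fun k => (Real.sqrt (W k))⁻¹ with hg_def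
  have hf0 : ∀ k, 0 ≤ f k := fun k => by simp only [hf_def]; positivity
  have hg0 : ∀ k, 0 ≤ g k := fun k => by simp only [hg_def]; positivity
  have hfg : ∀ k, f k * g k = c k := by
    intro k
    have hs : 0 < Real.sqrt (W k) := Real.sqrt_pos.2 (lt_of_lt_of_le one_pos (hW1 k))
    simp only [hf_def, hg_def]
    field_simp
  -- `f k ^ 2 ≤ G k`
  have hf2le : ∀ k, f k ^ (2 : ℝ) ≤ G k := by
    intro k
    rw [Real.rpow_two]
    have hWle : W k ≤ D * (1 + ∑ j, ((k j : ℝ) ^ 2) ^ (n + 1)) :=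
      one_add_freqNormSq_pow_succ_le k n
    calc f k ^ 2 = W k * c k ^ 2 := by
          simp only [hf_def]; rw [mul_pow, Real.sq_sqrt (hW0 k)]
      _ ≤ D * (1 + ∑ j, ((k j : ℝ) ^ 2) ^ (n + 1)) * c k ^ 2 :=
          mul_le_mul_of_nonneg_right hWle (sq_nonneg _)
      _ = D * (c k ^ 2 + ∑ j, ((k j : ℝ) ^ 2) ^ (n + 1) * c k ^ 2) := by
          rw [← Finset.sum_mul]; ring
      _ ≤ G k := by
          simp only [hG_def]
          gcongr with j _
          exact le_mul_of_one_le_left (sq_nonneg _) h4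
  have hf2s : Summable fun k => f k ^ (2 : ℝ) :=
    Summable.of_nonneg_of_le (fun k => Real.rpow_nonneg (hf0 k) _) hf2le hG.summable
  have hf2sum : ∑' k, f k ^ (2 : ℝ) ≤ D * ((Fintype.card ι : ℝ) + 1) * E :=
    ((hf2s.tsum_le_tsum hf2le hG.summable).trans_eq hG.tsum_eq).trans hGle
  -- `g k ^ 2` is the general term of the `p`-series
  have hg2eq : ∀ k, g k ^ (2 : ℝ) = (1 + freqNormSq k) ^ (-((n + 1 : ℕ) : ℝ)) := by
    intro k
    rw [Real.rpow_two, Real.rpow_neg (zero_le_one.trans (one_le_one_add_freqNormSq k)),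
      Real.rpow_natCast]
    simp only [hg_def]
    rw [inv_pow, Real.sq_sqrt (hW0 k)]
  have hg2s : Summable fun k => g k ^ (2 : ℝ) := by
    simp_rw [hg2eq]; exact hZs
  have hg2sum : ∑' k, g k ^ (2 : ℝ) = Z := by
    simp_rw [hg2eq]; rfl
  -- Cauchy–Schwarz
  have hCS := Real.inner_le_Lp_mul_Lq_tsum_of_nonneg Real.HolderConjugate.two_two hf0 hg0
    hf2s hg2s
  have hsup : ‖v x‖ ≤ ∑' k, f k * g k := by
    simp_rw [hfg]
    exact norm_le_tsum_norm_mFourierCoeff_complexify hv x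
  have hX0 : 0 ≤ ∑' k, f k ^ (2 : ℝ) := tsum_nonneg fun k => Real.rpow_nonneg (hf0 k) _
  have hY0 : 0 ≤ ∑' k, g k ^ (2 : ℝ) := tsum_nonneg fun k => Real.rpow_nonneg (hg0 k) _
  have hsq : ‖v x‖ ^ 2 ≤ (∑' k, f k ^ (2 : ℝ)) * ∑' k, g k ^ (2 : ℝ) := by
    have h1 := hsup.trans hCS
    have h2 := pow_le_pow_left₀ (norm_nonneg _) h1 2
    refine h2.trans (le_of_eq ?_)
    rw [mul_pow, ← Real.sqrt_eq_rpow, ← Real.sqrt_eq_rpow, Real.sq_sqrt hX0, Real.sq_sqrt hY0]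
  rw [hg2sum] at hsq
  calc ‖v x‖ ^ 2 ≤ (∑' k, f k ^ (2 : ℝ)) * Z := hsq
    _ ≤ D * ((Fintype.card ι : ℝ) + 1) * E * Z := mul_le_mul_of_nonneg_right hf2sum hZ0
    _ = Z * (D * ((Fintype.card ι : ℝ) + 1)) * E := by ring
    _ ≤ (Z * (D * ((Fintype.card ι : ℝ) + 1)) + 1) * E := by nlinarith

end Euclidean

/-! ## The word-form sup embedding as a named proposition, and its discharge -/

/-- **Word-form Sobolev sup embedding with margin `σ` on `𝕋^ι`**: for every finite-dimensional
real target `F'` there is `C_s > 0` with `‖f x‖² ≤ C_s · twordEnergy σ f` for all smooth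
`f : 𝕋^ι → F'` and all `x` (`H^σ ⊂ L^∞`, valid when `2σ > #ι`; the universe `u` of the targets is
a parameter). [cite: Grafakos2014, §3.3.3 (after Def. 3.3.15) with Prop. 3.2.5] -/
def WordSupEmbedding.{u, v} (ι : Type v) [Fintype ι] [DecidableEq ι] (σ : ℕ) : Prop :=
  ∀ (F' : Type u) [NormedAddCommGroup F'] [NormedSpace ℝ F'] [FiniteDimensional ℝ F'],
    ∃ Cs : ℝ, 0 < Cs ∧ ∀ f : UnitAddTorus ι → F', IsSmooth f → ∀ x,
      ‖f x‖ ^ 2 ≤ Cs * twordEnergy σ f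

/-- **`H^σ(𝕋^ι) ⊂ L^∞(𝕋^ι)` in word form for every `#ι < 2σ`** and every finite-dimensional
real target (reduction to `ℝⁿ` by a linear equivalence and
`Torus.exists_norm_sq_le_twordEnergy_euclidean`).
[cite: Grafakos2014, §3.3.3 (after Def. 3.3.15) with Prop. 3.2.5] -/
theorem wordSupEmbedding_of_lt.{u, v} {ι : Type v} [Fintype ι] [DecidableEq ι] {σ : ℕ}
    (hσ : Fintype.card ι < 2 * σ) : WordSupEmbedding.{u, v} ι σ := by
  intro F' _ _ _
  obtain ⟨C, hC, hCv⟩ :=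
    exists_norm_sq_le_twordEnergy_euclidean (ι := ι) (Fin (Module.finrank ℝ F')) hσ
  let e : F' ≃L[ℝ] EuclideanSpace ℝ (Fin (Module.finrank ℝ F')) :=
    ContinuousLinearEquiv.ofFinrankEq finrank_euclideanSpace_fin.symm
  obtain ⟨L, L', hLL⟩ : ∃ (L : F' →L[ℝ] EuclideanSpace ℝ (Fin (Module.finrank ℝ F')))
      (L' : EuclideanSpace ℝ (Fin (Module.finrank ℝ F')) →L[ℝ] F'), ∀ y, L' (L y) = y :=
    ⟨e, e.symm, fun y => e.symm_apply_apply y⟩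
  refine ⟨‖L'‖ ^ 2 * C * ‖L‖ ^ 2 + 1,
    add_pos_of_nonneg_of_pos (mul_nonneg (mul_nonneg (sq_nonneg _) hC.le) (sq_nonneg _)) one_pos,
    fun f hf x => ?_⟩
  have hv : IsSmooth (⇑L ∘ f) := hf.comp_clm L
  have h1 : ‖f x‖ ≤ ‖L'‖ * ‖(⇑L ∘ f) x‖ := by
    have h := L'.le_opNorm (L (f x))
    rwa [hLL] at h
  have hE : 0 ≤ twordEnergy σ f := twordEnergy_nonneg σ f
  calc ‖f x‖ ^ 2 ≤ (‖L'‖ * ‖(⇑L ∘ f) x‖) ^ 2 := pow_le_pow_left₀ (norm_nonneg _) h1 2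
    _ = ‖L'‖ ^ 2 * ‖(⇑L ∘ f) x‖ ^ 2 := mul_pow _ _ 2
    _ ≤ ‖L'‖ ^ 2 * (C * (‖L‖ ^ 2 * twordEnergy σ f)) := by
        refine mul_le_mul_of_nonneg_left ((hCv _ hv x).trans ?_) (sq_nonneg _)
        exact mul_le_mul_of_nonneg_left (twordEnergy_clm_comp_le hf L σ) hC.le
    _ = ‖L'‖ ^ 2 * C * ‖L‖ ^ 2 * twordEnergy σ f := by ring
    _ ≤ (‖L'‖ ^ 2 * C * ‖L‖ ^ 2 + 1) * twordEnergy σ f := by nlinarith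

/-- The rung `H²(𝕋³) ⊂ L^∞` in word form (`#ι = 3`, `σ = 2`), from the tree's real-variable
proof `Literature.Analysis.PDE.exists_norm_sq_le_twordEnergy_two`.
[cite: Adams1975, Thm. 5.4 Part I Case C (mp > n)] -/
theorem wordSupEmbedding_fin3_two.{u} : WordSupEmbedding.{u, 0} (Fin 3) 2 :=
  fun F' _ _ _ => exists_norm_sq_le_twordEnergy_two (F' := F') (Fintype.card_fin 3)

/-- Word-form sup embedding on `𝕋^d = (Fin d → 𝕋)` for `d < 2σ`.
[cite: Grafakos2014, §3.3.3 (after Def. 3.3.15) with Prop. 3.2.5] -/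
theorem wordSupEmbedding_fin.{u} {d σ : ℕ} (h : d < 2 * σ) : WordSupEmbedding.{u, 0} (Fin d) σ :=
  wordSupEmbedding_of_lt (by rwa [Fintype.card_fin])

/-- The rung `H³(𝕋⁴) ⊂ L^∞` in word form (`d = 4`, `σ = 3`), the instance consumed by the
four-dimensional symmetric-hyperbolic energy chain.
[cite: Grafakos2014, §3.3.3 (after Def. 3.3.15) with Prop. 3.2.5] -/
theorem wordSupEmbedding_fin4_three.{u} : WordSupEmbedding.{u, 0} (Fin 4) 3 :=
  wordSupEmbedding_fin (by norm_num)

end Torus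

end Literature.Analysis.FunctionSpaces

end
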